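import Mathlib
import HarnessLib
import Literature.MathematicalPhysics.QuantumLattice.GrassmannLinearSubstitution
import Literature.MathematicalPhysics.QuantumLattice.HubbardGridFieldSubstitution
import Literature.MathematicalPhysics.QuantumLattice.SymmetricRegimeFunctionals

/-!
# Route `KLProgramme` — crux K3 ENGINE (gen-3 stmt-…-19823 `KLRegimeEngineV11`), stub `stub_engine_scale0`, item (I10) of
# HOME/hubbard-kl-k3c2-p1/SCALE0-GRAM.md: momentum-space VALUES are dominated by position/grid-space kernel `ℓ¹` norms
# (cell gate-hubbard-kl, seat hubbard-kl-k3c2-p1)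

The «Fourier-inversion domination» the values clauses of the scale-`0` rung need ((E2-v7)₀: `‖𝒞₀ − U‖ ≤ …`, from the grid-kernel
bounds the determinant-bounded step produces): for a linear substitution of generators `f` with matrix entries `‖M a b‖ ≤ B`, every
kernel coefficient of `map f F` is at most `B^m · Σ_X ‖kernel F m X‖` — the triangle inequality on
`GrassmannLinearSubstitution.kernel_map`.  Applied with `f = toLin' (hubbardGridSub L M β N)` it bounds the momentum-space kernels of
`klEffectiveAction … 0 = map S (effAction (Sᵀ C S) V_grid)` (functoriality `effAction_map`) by the grid kernels' `ℓ¹` norms.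
Plus the entry bound `‖hubbardGridSub … K Y‖ ≤ 1/(βL²)` and the grid instance `norm_kernel_map_hubbardGridSub_le`.
-/

noncomputable section

namespace Summit.HubbardSuperconductivity.HubbardSuperconductivity.Theorems.EngineV8

set_option linter.dupNamespace false

open Finset Literature.MathematicalPhysics.QuantumLattice GrassmannAlgebra

/-- **Kernel coefficients after a linear substitution are dominated by the `ℓ¹` norm of the original kernel**: if every matrix entry
of `f` has norm `≤ B`, then `‖kernel (map f F) m X′‖ ≤ B^m · Σ_X ‖kernel F m X‖`. -/
theorem norm_kernel_map_le {Γ Γ' : Type*} [Fintype Γ] [DecidableEq Γ] [LinearOrder Γ] [Fintype Γ'] [DecidableEq Γ']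
    [LinearOrder Γ'] (f : (Γ → ℂ) →ₗ[ℂ] (Γ' → ℂ)) (F : GrassmannAlgebra ℂ Γ) (m : ℕ) (X' : Fin m → Γ') {B : ℝ}
    (hM : ∀ a b, ‖LinearMap.toMatrix' f a b‖ ≤ B) :
    ‖kernel ℂ (ExteriorAlgebra.map f F) m X'‖ ≤ B ^ m * ∑ X : Fin m → Γ, ‖kernel ℂ F m X‖ := by
  rw [kernel_map, mul_sum]
  refine (norm_sum_le _ _).trans (sum_le_sum fun X _ => ?_)
  rw [norm_mul, norm_prod]
  refine mul_le_mul_of_nonneg_right ?_ (norm_nonneg _)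
  calc ∏ i, ‖LinearMap.toMatrix' f (X' i) (X i)‖ ≤ ∏ _i : Fin m, B :=
        prod_le_prod (fun i _ => norm_nonneg _) fun i _ => hM _ _
    _ = B ^ m := by rw [prod_const, card_univ, Fintype.card_fin]

/-- `norm_kernel_map_le` WITHOUT the (superfluous) linear-order instances — the form usable for the grid legs:
`‖kernel (map f F) m X′‖ ≤ B^m · Σ_X ‖kernel F m X‖` whenever every matrix entry of `f` has norm `≤ B`. -/
theorem norm_kernel_map_le' {Γ Γ' : Type*} [Fintype Γ] [DecidableEq Γ] [Fintype Γ'] [DecidableEq Γ']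
    (f : (Γ → ℂ) →ₗ[ℂ] (Γ' → ℂ)) (F : GrassmannAlgebra ℂ Γ) (m : ℕ) (X' : Fin m → Γ') {B : ℝ}
    (hM : ∀ a b, ‖LinearMap.toMatrix' f a b‖ ≤ B) :
    ‖kernel ℂ (ExteriorAlgebra.map f F) m X'‖ ≤ B ^ m * ∑ X : Fin m → Γ, ‖kernel ℂ F m X‖ := by
  rw [kernel_map, mul_sum]
  refine (norm_sum_le _ _).trans (sum_le_sum fun X _ => ?_)
  rw [norm_mul, norm_prod]
  refine mul_le_mul_of_nonneg_right ?_ (norm_nonneg _)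
  calc ∏ i, ‖LinearMap.toMatrix' f (X' i) (X i)‖ ≤ ∏ _i : Fin m, B :=
        prod_le_prod (fun i _ => norm_nonneg _) fun i _ => hM _ _
    _ = B ^ m := by rw [prod_const, card_univ, Fintype.card_fin]

/-- The grid substitution matrix has entries of norm `≤ 1/(βL²)` (a normalised plane wave or `0`). -/
theorem norm_hubbardGridSub_apply_le {L M : ℕ} [NeZero L] {β : ℝ} (hβ : 0 < β) (N : ℕ) (K : HubbardFieldIdx L M)
    (Y : GridLeg (GridPoint L N)) : ‖hubbardGridSub L M β N K Y‖ ≤ 1 / (β * (L : ℝ) ^ 2) := by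
  have h0 : 0 ≤ 1 / (β * (L : ℝ) ^ 2) := by positivity
  rw [hubbardGridSub, gridSubMatrix_apply]
  split_ifs
  · rw [norm_mul, Complex.norm_real, Real.norm_eq_abs, abs_of_nonneg h0, RCLike.norm_conj, norm_vertexPlaneWave, mul_one]
  · rw [norm_zero]; exact h0

/-- **Momentum-space kernels of a grid functional are dominated by the grid kernels' `ℓ¹` norm**:
`‖kernel (map S F) m X′‖ ≤ (βL²)^{-m} · Σ_X ‖kernel F m X‖` for the grid substitution `S = toLin' (hubbardGridSub L M β N)` — with
`effAction_map` this bounds every coefficient (hence every VALUE `vertexFn`, `𝒞₀`, `λ₀`) of `klEffectiveAction … 0 = map S (effAction (Sᵀ C S) V_grid)`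
by the position-space kernel norms the determinant-bounded step delivers. -/
theorem norm_kernel_map_hubbardGridSub_le {L M : ℕ} [NeZero L] {β : ℝ} (hβ : 0 < β) (N : ℕ)
    (F : GrassmannAlgebra ℂ (GridLeg (GridPoint L N))) (m : ℕ) (X' : Fin m → HubbardFieldIdx L M) :
    ‖kernel ℂ (ExteriorAlgebra.map (Matrix.toLin' (hubbardGridSub L M β N)) F) m X'‖ ≤
      (1 / (β * (L : ℝ) ^ 2)) ^ m * ∑ X : Fin m → GridLeg (GridPoint L N), ‖kernel ℂ F m X‖ :=
  norm_kernel_map_le' _ F m X' fun a b => by rw [LinearMap.toMatrix'_toLin']; exact norm_hubbardGridSub_apply_le hβ N a b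

/-- **Vertex functions of a grid functional are dominated by the grid kernels' `ℓ¹` norm**: with Salmhofer's normalisation
`𝒱_m = m!·(βL²)^{m−1}·kernel`, `‖𝒱_m(map S F)(X′)‖ ≤ (m!/(βL²)) · Σ_X ‖kernel F m X‖` — so the pair amplitude `𝒞₀ = 𝒱₄(…)` and the running
coupling `λ₀` of `klEffectiveAction … 0 = map S (effAction (Sᵀ C S) V_grid)` are bounded by `24/(βL²)` times the total `ℓ¹` mass of the grid
four-point kernel (= `#pins · pinned norm`, `#pins = 4·N·L²`, against the grid vertex scale `ε_N = β/N`). -/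
theorem norm_vertexFn_map_hubbardGridSub_le {L M : ℕ} [NeZero L] [NeZero M] {β : ℝ} (hβ : 0 < β) (N : ℕ)
    (F : GrassmannAlgebra ℂ (GridLeg (GridPoint L N))) {m : ℕ} (hm : 1 ≤ m) (X' : Fin m → HubbardFieldIdx L M) :
    ‖vertexFn L M β (ExteriorAlgebra.map (Matrix.toLin' (hubbardGridSub L M β N)) F) m X'‖ ≤
      (m.factorial : ℝ) / (β * (L : ℝ) ^ 2) * ∑ X : Fin m → GridLeg (GridPoint L N), ‖kernel ℂ F m X‖ := by
  have hL : (0 : ℝ) < L := by exact_mod_cast Nat.pos_of_ne_zero (NeZero.ne L)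
  have hβL : 0 < β * (L : ℝ) ^ 2 := by positivity
  obtain ⟨j, rfl⟩ : ∃ j, m = j + 1 := ⟨m - 1, by omega⟩
  have hk := norm_kernel_map_hubbardGridSub_le (M := M) hβ N F (j + 1) X'
  rw [vertexFn, norm_mul, Complex.norm_real, Real.norm_eq_abs, abs_of_nonneg (by positivity), Nat.add_sub_cancel]
  calc ((j + 1).factorial : ℝ) * (β * (L : ℝ) ^ 2) ^ j *
        ‖kernel ℂ (ExteriorAlgebra.map (Matrix.toLin' (hubbardGridSub L M β N)) F) (j + 1) X'‖
      ≤ ((j + 1).factorial : ℝ) * (β * (L : ℝ) ^ 2) ^ j * ((1 / (β * (L : ℝ) ^ 2)) ^ (j + 1) * ∑ X, ‖kernel ℂ F (j + 1) X‖) :=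
        mul_le_mul_of_nonneg_left hk (by positivity)
    _ = ((j + 1).factorial : ℝ) / (β * (L : ℝ) ^ 2) * ∑ X, ‖kernel ℂ F (j + 1) X‖ := by
        rw [pow_succ, one_div, inv_pow]
        field_simp
        ring

/-- From a PINNED `ℓ¹` bound (one leg fixed, as `sum_norm_kernel_effAction_le_of_gramBounded` delivers it) to the total `ℓ¹` mass:
`Σ_W ‖k W‖ ≤ #Γ · B` whenever `Σ_{W : W 0 = w} ‖k W‖ ≤ B` for every `w`. -/
theorem sum_norm_le_card_mul_of_pinned {Γ : Type*} [Fintype Γ] [DecidableEq Γ] {m : ℕ} (hm : 0 < m) (k : (Fin m → Γ) → ℂ)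
    {B : ℝ} (hB : ∀ w : Γ, ∑ W ∈ univ.filter (fun W : Fin m → Γ => W ⟨0, hm⟩ = w), ‖k W‖ ≤ B) :
    ∑ W : Fin m → Γ, ‖k W‖ ≤ Fintype.card Γ * B := by
  have h := Finset.sum_fiberwise_of_maps_to (s := (univ : Finset (Fin m → Γ))) (t := (univ : Finset Γ))
    (g := fun W : Fin m → Γ => W ⟨0, hm⟩) (fun W _ => mem_univ _) (fun W => ‖k W‖)
  rw [← h]
  calc ∑ w : Γ, ∑ W ∈ univ.filter (fun W : Fin m → Γ => W ⟨0, hm⟩ = w), ‖k W‖ ≤ ∑ _w : Γ, B := sum_le_sum fun w _ => hB w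
    _ = Fintype.card Γ * B := by rw [sum_const, card_univ, nsmul_eq_mul]

/-- **Values from the pinned grid-kernel bounds of the determinant-bounded step**: if every pinned `ℓ¹` sum of the grid `m`-kernel of `F`
is `≤ B` (the output shape of `sum_norm_kernel_effAction_le_of_gramBounded`), then every Salmhofer-normalised vertex function of
`map S F` satisfies `‖𝒱_m(X′)‖ ≤ (m!/(βL²)) · #(grid legs) · B` (`#(grid legs) = 4·N·L²`; with the grid vertex scale `ε_N = β/N` inside
`B` this is `M`-, `β`- and `L`-uniform). -/
theorem norm_vertexFn_map_hubbardGridSub_le_of_pinned {L M : ℕ} [NeZero L] [NeZero M] {β : ℝ} (hβ : 0 < β) (N : ℕ)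
    (F : GrassmannAlgebra ℂ (GridLeg (GridPoint L N))) {m : ℕ} (hm : 1 ≤ m) (X' : Fin m → HubbardFieldIdx L M) {B : ℝ}
    (hB : ∀ w : GridLeg (GridPoint L N),
      ∑ W ∈ univ.filter (fun W : Fin m → GridLeg (GridPoint L N) => W ⟨0, hm⟩ = w), ‖kernel ℂ F m W‖ ≤ B) :
    ‖vertexFn L M β (ExteriorAlgebra.map (Matrix.toLin' (hubbardGridSub L M β N)) F) m X'‖ ≤
      (m.factorial : ℝ) / (β * (L : ℝ) ^ 2) * (Fintype.card (GridLeg (GridPoint L N)) * B) := by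
  have hL : (0 : ℝ) < L := by exact_mod_cast Nat.pos_of_ne_zero (NeZero.ne L)
  refine (norm_vertexFn_map_hubbardGridSub_le hβ N F hm X').trans ?_
  exact mul_le_mul_of_nonneg_left (sum_norm_le_card_mul_of_pinned hm _ hB) (by positivity)

/-- The number of grid legs: `#GridLeg (GridPoint L N) = 4·N·L²` (charge × spin × time slices × sites). -/
theorem card_gridLeg_gridPoint (L N : ℕ) [NeZero L] : Fintype.card (GridLeg (GridPoint L N)) = 4 * N * L ^ 2 := by
  have hT : Fintype.card (Literature.Probability.LatticeModels.TorusSite 2 L) = L ^ 2 := by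
    simp [Literature.Probability.LatticeModels.TorusSite, ZMod.card]
  simp only [Fintype.card_prod, Fintype.card_fin, hT]
  ring

end Summit.HubbardSuperconductivity.HubbardSuperconductivity.Theorems.EngineV8

end
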